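import Summits.QuantumFields.YangMills.Theorems.PoincareLipschitzAvgStabilityOfOrbitMinimising
import Literature.MathematicalPhysics.QuantumFieldTheory.Balaban1983to89.T4PairDerivBridge
import HarnessLib

/-!
# Crux stmt-QuantumFields-19936 `UnitScaleTilt.HistoryTailL`, K2 at depth (route crux `PoincareLipschitz.BlockLipschitzL`, stmt-QuantumFields-23533):
# THE NON-TRIVIAL REGIME OF «AVERAGE STABILITY MODULO GAUGE» — the supplier may assume the pair is orbit-minimising AND box-`ℓ²`-close

✓`PoincareLipschitzAvgStabilityOrbitMin.avgStabilityModGauge_of_orbitMinimising` (this seat, p681042) reduced the displayed row of the K2-TOP door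
(✓p679967) to pairs `(U, U')` in which `U'` is a box-`ℓ²`-closest point of its own level-zero gauge orbit to `U`.  This file adds the second free
reduction: since `dist1 ≤ 2` on `SU(2)` (✓`T4PairDerivBridge.dist1_le_two_specialUnitaryGroup`), the row is trivially true (with `h := 1`)
whenever its right side `CS/√(L^{j+1})·‖X(U,U')‖_{ℓ²(box)}` exceeds `2`, i.e. whenever `‖X‖² > 4·L^{j+1}/CS²`.  So a supplier who
announces a POSITIVE constant `CS` only has to treat orbit-minimising pairs with
`Σ_{b ∈ box} dist1(U_b U'_b⁻¹)² ≤ 4·L^{j+1}/CS²` (`avgStabilityModGauge_of_orbitMinimising_of_small`), and through the door the registered stub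
follows (`stub_iteratedLipschitz_of_avgStabilityOrbitMinSmall`).

THE POINT (for the elliptic step (R3) and the card): in that regime the perturbation `W_b = U'_bU_b⁻¹` is `ℓ²`-SMALL OUTRIGHT — the box has
`3·(17·L^{j+1})³` bonds, so the mean of `dist1(W_b)²` over the box is `≤ (4/(3·17³·CS²))·L^{−2(j+1)}` — with NO gauge-alignment lemma; together with
the covariant Coulomb condition of the minimiser (✓p681590, ✓p682271: every site matrix is a non-negative real scalar) and the curl-smallness given
by the local goodness of both fields, this is the input of the interior sup-smallness step, after which [Balaban1985Averaging] Props. 3–5 apply.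

WHAT THIS IS NOT: nothing here proves the restricted row, `stub_iteratedLipschitz`, the crux `BlockLipschitzL`, the crux `HistoryTailL`, rung R3
(YM₃ on T³ — not d = 4, not infinite volume, not a mass gap, not the Clay problem) or a summit statement.
Width seat ym-ust-19936-w5 g10 (cell ym3-torus), `--supports stmt-QuantumFields-19936`.
-/

noncomputable section

open scoped BigOperators Matrix.Norms.L2Operator

namespace Summit.QuantumFields.YangMills.Theorems.PoincareLipschitzAvgStabilityNontrivial

open Literature.MathematicalPhysics.QuantumFieldTheory.Balaban1983to89
open Literature.MathematicalPhysics.QuantumFieldTheory.Balaban1983to89.T3ContinuumYM3Torus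
open Literature.MathematicalPhysics.QuantumFieldTheory.Balaban1983to89.T3UnitLawDensityEML
open T4Continuum BlockAveraging AveragingRT T3UnitScaleTilt
open Summit.QuantumFields.YangMills.Theorems.PoincareLipschitzIteratedOfAvgStability (stub_iteratedLipschitz_of_avgStabilityModGauge)
open Summit.QuantumFields.YangMills.Theorems.PoincareLipschitzAvgStabilityOrbitMin (avgStabilityModGauge_of_orbitMinimising)

/-! ## §1 The trivial regime: a large box distance makes the row free -/

section Trivial

/-- If `CS > 0`, `0 < ℓ` and `S > 4ℓ/CS²`, then `2 ≤ CS/√ℓ · √S`. [folklore] -/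
theorem two_le_of_large {CS ℓ S : ℝ} (hCS : 0 < CS) (hℓ : 0 < ℓ) (hS : 4 * ℓ / CS ^ 2 < S) :
    2 ≤ CS / Real.sqrt ℓ * Real.sqrt S := by
  have hsl : 0 < Real.sqrt ℓ := Real.sqrt_pos.2 hℓ
  have h1 : 2 * Real.sqrt ℓ / CS ≤ Real.sqrt S := by
    rw [Real.le_sqrt' (by positivity)]
    rw [div_pow, mul_pow, Real.sq_sqrt hℓ.le]
    have : (2 : ℝ) ^ 2 * ℓ / CS ^ 2 = 4 * ℓ / CS ^ 2 := by norm_num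
    rw [this]
    exact hS.le
  calc (2 : ℝ) = CS / Real.sqrt ℓ * (2 * Real.sqrt ℓ / CS) := by field_simp
    _ ≤ CS / Real.sqrt ℓ * Real.sqrt S := mul_le_mul_of_nonneg_left h1 (by positivity)

end Trivial

/-! ## §2 The row on orbit-minimising, box-`ℓ²`-close pairs suffices -/

section Door

/-- ★★ **«AVERAGE STABILITY MODULO GAUGE» ⟸ THE SAME ROW ON ORBIT-MINIMISING, BOX-`ℓ²`-CLOSE PAIRS.**  If for each `L` there is a POSITIVE `CS`
such that the displayed row of the K2-TOP door holds for all locally hierarchically small pairs `(U, U')` with `U'` box-`ℓ²`-orbit-minimising AND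
`Σ_box dist1(U_b U'_b⁻¹)² ≤ 4·L^{j+1}/CS²`, then the full row holds with the same `CS` (large distance: `h := 1`, `dist1 ≤ 2 ≤ CS/√(L^{j+1})·√Σ`
by `two_le_of_large`; small distance: the hypothesis; then ✓`avgStabilityModGauge_of_orbitMinimising`). [cite: Balaban1985Averaging, (11) p.19] -/
theorem avgStabilityModGauge_of_orbitMinimising_of_small
    (hSmall : open Literature.MathematicalPhysics.QuantumFieldTheory.Balaban1983to89 Literature.MathematicalPhysics.QuantumFieldTheory.Balaban1983to89.T3ContinuumYM3Torus in ∀ (L : ℕ), ∃ CS : ℝ, 0 < CS ∧ ∀ (b₀ p₀ : ℝ), 0 < b₀ → 2 < p₀ → ∃ γ₁ : ℝ, 0 < γ₁ ∧ γ₁ ≤ 1 ∧ ∀ (F : T3Family) (γ : ℝ), F.L = L → 0 < γ → γ ≤ γ₁ → ∀ (K j : ℕ), 1 ≤ j → j + 3 ≤ K → ∀ (a : Plaq (F.P K) (j + 1)) (U U' : GaugeField (F.P K) 0 (Matrix.specialUnitaryGroup (Fin 2) ℂ)), (∀ (i : ℕ) (q : Plaq (F.P K) i), i < j + 1 → Site.tdist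 (fun k => ((((q.src k).val * F.L ^ i : ℕ)) : ZMod ((F.P K).sitesPerDir 0))) (fun k => ((((a.src k).val * F.L ^ (j + 1) : ℕ)) : ZMod ((F.P K).sitesPerDir 0))) + 64 * F.L ^ i ≤ 64 * F.L ^ (j + 1) → GaugeGroup.dist1 (GaugeField.plaqHol (Averaging.iter (fun i' => BlockAveraging.blockAvg (P := F.P K) (j := i') T3UnitLawDensityEML.ℰp) i U) q) < T3UnitScaleTilt.θBal F.L γ b₀ p₀ (K - i)) → (∀ (i : ℕ) (q : Plaq (F.P K) i), i < j + 1 → Site.tdist (fun k => ((((q.src k).val * F.L ^ i : ℕ)) : ZMod ((F.P K).sitesPerDir 0))) (fun k => ((((a.src k).val * F.L ^ (j + 1) : ℕ)) : ZMod ((F.P K).sitesPerDir 0))) + 64 * F.L ^ i ≤ 64 * F.L ^ (j + 1) → GaugeGroup.dist1 (GaugeField.plaqHol (Averaging.iter (fun i' => BlockAveraging.blockAvg (P := F.P K) (j := i') T3UnitLawDensityEML.ℰp) i U') q) < T3UnitScaleTilt.θBal F.L γ b₀ p₀ (K - i)) → (∀ k : GaugeTransf (F.P K) 0 (Matrix.specialUnitaryGroup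 (Fin 2) ℂ), (∑ b : PBond (F.P K) 0, if (∀ k, (b.src k - ((((a.src k).val * F.L ^ (j + 1) : ℕ)) : ZMod ((F.P K).sitesPerDir 0)) + ((8 * F.L ^ (j + 1) : ℕ) : ZMod ((F.P K).sitesPerDir 0))).val < 17 * F.L ^ (j + 1)) ∧ (∀ k, (b.tgt k - ((((a.src k).val * F.L ^ (j + 1) : ℕ)) : ZMod ((F.P K).sitesPerDir 0)) + ((8 * F.L ^ (j + 1) : ℕ) : ZMod ((F.P K).sitesPerDir 0))).val < 17 * F.L ^ (j + 1)) then GaugeGroup.dist1 (U b * (U' b)⁻¹) ^ 2 else 0) ≤ (∑ b : PBond (F.P K) 0, if (∀ k, (b.src k - ((((a.src k).val * F.L ^ (j + 1) : ℕ)) : ZMod ((F.P K).sitesPerDir 0)) + ((8 * F.L ^ (j + 1) : ℕ) : ZMod ((F.P K).sitesPerDir 0))).val < 17 * F.L ^ (j + 1)) ∧ (∀ k, (b.tgt k - ((((a.src k).val * F.L ^ (j + 1) : ℕ)) : ZMod ((F.P K).sitesPerDir 0)) + ((8 * F.L ^ (j + 1) : ℕ) : ZMod ((F.P K).sitesPerDir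 0))).val < 17 * F.L ^ (j + 1)) then GaugeGroup.dist1 (U b * (GaugeField.gaugeAct k U' b)⁻¹) ^ 2 else 0)) → (∑ b : PBond (F.P K) 0, if (∀ k, (b.src k - ((((a.src k).val * F.L ^ (j + 1) : ℕ)) : ZMod ((F.P K).sitesPerDir 0)) + ((8 * F.L ^ (j + 1) : ℕ) : ZMod ((F.P K).sitesPerDir 0))).val < 17 * F.L ^ (j + 1)) ∧ (∀ k, (b.tgt k - ((((a.src k).val * F.L ^ (j + 1) : ℕ)) : ZMod ((F.P K).sitesPerDir 0)) + ((8 * F.L ^ (j + 1) : ℕ) : ZMod ((F.P K).sitesPerDir 0))).val < 17 * F.L ^ (j + 1)) then GaugeGroup.dist1 (U b * (U' b)⁻¹) ^ 2 else 0) ≤ 4 * (F.L : ℝ) ^ (j + 1) / CS ^ 2 → ∃ h : GaugeTransf (F.P K) j (Matrix.specialUnitaryGroup (Fin 2) ℂ), ∀ c : PBond (F.P K) (j + 1), (c = ⟨a.src, a.μ⟩ ∨ c = ⟨a.src.shift a.μ, a.ν⟩ ∨ c = ⟨a.src.shift a.ν, a.μ⟩ ∨ c = ⟨a.src, a.ν⟩)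 → ∀ b : PBond (F.P K) j, (blockOf b.src = c.src ∨ blockOf b.src = c.tgt) → (blockOf b.tgt = c.src ∨ blockOf b.tgt = c.tgt) → GaugeGroup.dist1 (Averaging.iter (fun i' => BlockAveraging.blockAvg (P := F.P K) (j := i') T3UnitLawDensityEML.ℰp) j U b * (GaugeField.gaugeAct h (Averaging.iter (fun i' => BlockAveraging.blockAvg (P := F.P K) (j := i') T3UnitLawDensityEML.ℰp) j U') b)⁻¹) ≤ CS / Real.sqrt ((F.L : ℝ) ^ (j + 1)) * Real.sqrt (∑ b : PBond (F.P K) 0, if (∀ k, (b.src k - ((((a.src k).val * F.L ^ (j + 1) : ℕ)) : ZMod ((F.P K).sitesPerDir 0)) + ((8 * F.L ^ (j + 1) : ℕ) : ZMod ((F.P K).sitesPerDir 0))).val < 17 * F.L ^ (j + 1)) ∧ (∀ k, (b.tgt k - ((((a.src k).val * F.L ^ (j + 1) : ℕ)) : ZMod ((F.P K).sitesPerDir 0)) + ((8 * F.L ^ (j + 1) : ℕ) : ZMod ((F.P K).sitesPerDir 0))).val < 17 * F.L ^ (j + 1)) then GaugeGroup.dist1 (U b * (U' b)⁻¹) ^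 2 else 0)) :
    open Literature.MathematicalPhysics.QuantumFieldTheory.Balaban1983to89 Literature.MathematicalPhysics.QuantumFieldTheory.Balaban1983to89.T3ContinuumYM3Torus in ∀ (L : ℕ), ∃ CS : ℝ, 0 ≤ CS ∧ ∀ (b₀ p₀ : ℝ), 0 < b₀ → 2 < p₀ → ∃ γ₁ : ℝ, 0 < γ₁ ∧ γ₁ ≤ 1 ∧ ∀ (F : T3Family) (γ : ℝ), F.L = L → 0 < γ → γ ≤ γ₁ → ∀ (K j : ℕ), 1 ≤ j → j + 3 ≤ K → ∀ (a : Plaq (F.P K) (j + 1)) (U U' : GaugeField (F.P K) 0 (Matrix.specialUnitaryGroup (Fin 2) ℂ)), (∀ (i : ℕ) (q : Plaq (F.P K) i), i < j + 1 → Site.tdist (fun k => ((((q.src k).val * F.L ^ i : ℕ)) : ZMod ((F.P K).sitesPerDir 0))) (fun k => ((((a.src k).val * F.L ^ (j + 1) : ℕ)) : ZMod ((F.P K).sitesPerDir 0))) + 64 * F.L ^ i ≤ 64 * F.L ^ (j + 1) → GaugeGroup.dist1 (GaugeField.plaqHol (Averaging.iter (fun i' => BlockAveraging.blockAvg (P :=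 F.P K) (j := i') T3UnitLawDensityEML.ℰp) i U) q) < T3UnitScaleTilt.θBal F.L γ b₀ p₀ (K - i)) → (∀ (i : ℕ) (q : Plaq (F.P K) i), i < j + 1 → Site.tdist (fun k => ((((q.src k).val * F.L ^ i : ℕ)) : ZMod ((F.P K).sitesPerDir 0))) (fun k => ((((a.src k).val * F.L ^ (j + 1) : ℕ)) : ZMod ((F.P K).sitesPerDir 0))) + 64 * F.L ^ i ≤ 64 * F.L ^ (j + 1) → GaugeGroup.dist1 (GaugeField.plaqHol (Averaging.iter (fun i' => BlockAveraging.blockAvg (P := F.P K) (j := i') T3UnitLawDensityEML.ℰp) i U') q) < T3UnitScaleTilt.θBal F.L γ b₀ p₀ (K - i)) → ∃ h : GaugeTransf (F.P K) j (Matrix.specialUnitaryGroup (Fin 2) ℂ), ∀ c : PBond (F.P K) (j + 1), (c = ⟨a.src, a.μ⟩ ∨ c = ⟨a.src.shift a.μ, a.ν⟩ ∨ c = ⟨a.src.shift a.ν, a.μ⟩ ∨ c = ⟨a.src, a.ν⟩) → ∀ b : PBond (F.P K) j, (blockOf b.src = c.src ∨ blockOf b.src = c.tgt) → (blockOf b.tgt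 = c.src ∨ blockOf b.tgt = c.tgt) → GaugeGroup.dist1 (Averaging.iter (fun i' => BlockAveraging.blockAvg (P := F.P K) (j := i') T3UnitLawDensityEML.ℰp) j U b * (GaugeField.gaugeAct h (Averaging.iter (fun i' => BlockAveraging.blockAvg (P := F.P K) (j := i') T3UnitLawDensityEML.ℰp) j U') b)⁻¹) ≤ CS / Real.sqrt ((F.L : ℝ) ^ (j + 1)) * Real.sqrt (∑ b : PBond (F.P K) 0, if (∀ k, (b.src k - ((((a.src k).val * F.L ^ (j + 1) : ℕ)) : ZMod ((F.P K).sitesPerDir 0)) + ((8 * F.L ^ (j + 1) : ℕ) : ZMod ((F.P K).sitesPerDir 0))).val < 17 * F.L ^ (j + 1)) ∧ (∀ k, (b.tgt k - ((((a.src k).val * F.L ^ (j + 1) : ℕ)) : ZMod ((F.P K).sitesPerDir 0)) + ((8 * F.L ^ (j + 1) : ℕ) : ZMod ((F.P K).sitesPerDir 0))).val < 17 * F.L ^ (j + 1)) then GaugeGroup.dist1 (U b * (U' b)⁻¹) ^ 2 else 0) := by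
  refine avgStabilityModGauge_of_orbitMinimising ?_
  intro L
  obtain ⟨CS, hCS, HS⟩ := hSmall L
  refine ⟨CS, hCS.le, ?_⟩
  intro b₀ p₀ hb hp
  obtain ⟨γ₁, hγ₁, hγ₁1, HS'⟩ := HS b₀ p₀ hb hp
  refine ⟨γ₁, hγ₁, hγ₁1, ?_⟩
  intro F γ hFL hγ hγle K j hj hjK a U U' hU hU' hmin
  by_cases hsm : (∑ b : PBond (F.P K) 0, if (∀ k, (b.src k - ((((a.src k).val * F.L ^ (j + 1) : ℕ)) : ZMod ((F.P K).sitesPerDir 0)) + ((8 * F.L ^ (j + 1) : ℕ) : ZMod ((F.P K).sitesPerDir 0))).val < 17 * F.L ^ (j + 1)) ∧ (∀ k, (b.tgt k - ((((a.src k).val * F.L ^ (j + 1) : ℕ)) : ZMod ((F.P K).sitesPerDir 0)) + ((8 * F.L ^ (j + 1) : ℕ) : ZMod ((F.P K).sitesPerDir 0))).val < 17 * F.L ^ (j + 1)) then GaugeGroup.dist1 (U b * (U' b)⁻¹) ^ 2 else 0) ≤ 4 * (F.L : ℝ) ^ (j + 1) / CS ^ 2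
  · exact HS' F γ hFL hγ hγle K j hj hjK a U U' hU hU' hmin hsm
  · -- the trivial regime: every `dist1` is at most `2 ≤ CS/√(L^{j+1})·√Σ`
    have hsm' : 4 * (F.L : ℝ) ^ (j + 1) / CS ^ 2 < _ := lt_of_not_ge hsm
    have hL3 : 3 ≤ F.L := (by obtain ⟨k, hk⟩ := F.hL.1; have := F.hL.2; omega)
    have hℓ : 0 < (F.L : ℝ) ^ (j + 1) := by positivity
    have h2 := two_le_of_large hCS hℓ hsm'
    refine ⟨fun _ => 1, ?_⟩
    intro c hc b hbs hbt
    exact (T4PairDerivBridge.dist1_le_two_specialUnitaryGroup _).trans h2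

end Door

/-! ## §3 The registered stub from the doubly restricted row -/

section Stub

/-- ★ **`stub_iteratedLipschitz` ⟸ «AVERAGE STABILITY MODULO GAUGE ON ORBIT-MINIMISING, BOX-ℓ²-CLOSE PAIRS»** (VERBATIM registered signature of
`Cruxes/HistoryTailL/Lines/poincare_lipschitz.lean`, `CL := 484·L·CS`): `avgStabilityModGauge_of_orbitMinimising_of_small` followed by the
K2-TOP door ✓`stub_iteratedLipschitz_of_avgStabilityModGauge`. [cite: Balaban1987RG1, (0.4) p.253; Balaban1985Averaging, (11) p.19] -/
theorem stub_iteratedLipschitz_of_avgStabilityOrbitMinSmall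
    (hSmall : open Literature.MathematicalPhysics.QuantumFieldTheory.Balaban1983to89 Literature.MathematicalPhysics.QuantumFieldTheory.Balaban1983to89.T3ContinuumYM3Torus in ∀ (L : ℕ), ∃ CS : ℝ, 0 < CS ∧ ∀ (b₀ p₀ : ℝ), 0 < b₀ → 2 < p₀ → ∃ γ₁ : ℝ, 0 < γ₁ ∧ γ₁ ≤ 1 ∧ ∀ (F : T3Family) (γ : ℝ), F.L = L → 0 < γ → γ ≤ γ₁ → ∀ (K j : ℕ), 1 ≤ j → j + 3 ≤ K → ∀ (a : Plaq (F.P K) (j + 1)) (U U' : GaugeField (F.P K) 0 (Matrix.specialUnitaryGroup (Fin 2) ℂ)), (∀ (i : ℕ) (q : Plaq (F.P K) i), i < j + 1 → Site.tdist (fun k => ((((q.src k).val * F.L ^ i : ℕ)) : ZMod ((F.P K).sitesPerDir 0))) (fun k => ((((a.src k).val * F.L ^ (j + 1) : ℕ)) : ZMod ((F.P K).sitesPerDir 0))) + 64 * F.L ^ i ≤ 64 * F.L ^ (j + 1) → GaugeGroup.dist1 (GaugeField.plaqHol (Averaging.iter (fun i' => BlockAveraging.blockAvg (P := F.P K) (j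 := i') T3UnitLawDensityEML.ℰp) i U) q) < T3UnitScaleTilt.θBal F.L γ b₀ p₀ (K - i)) → (∀ (i : ℕ) (q : Plaq (F.P K) i), i < j + 1 → Site.tdist (fun k => ((((q.src k).val * F.L ^ i : ℕ)) : ZMod ((F.P K).sitesPerDir 0))) (fun k => ((((a.src k).val * F.L ^ (j + 1) : ℕ)) : ZMod ((F.P K).sitesPerDir 0))) + 64 * F.L ^ i ≤ 64 * F.L ^ (j + 1) → GaugeGroup.dist1 (GaugeField.plaqHol (Averaging.iter (fun i' => BlockAveraging.blockAvg (P := F.P K) (j := i') T3UnitLawDensityEML.ℰp) i U') q) < T3UnitScaleTilt.θBal F.L γ b₀ p₀ (K - i)) → (∀ k : GaugeTransf (F.P K) 0 (Matrix.specialUnitaryGroup (Fin 2) ℂ), (∑ b : PBond (F.P K) 0, if (∀ k, (b.src k - ((((a.src k).val * F.L ^ (j + 1) : ℕ)) : ZMod ((F.P K).sitesPerDir 0)) + ((8 * F.L ^ (j + 1) : ℕ) : ZMod ((F.P K).sitesPerDir 0))).val < 17 * F.L ^ (j + 1)) ∧ (∀ k, (b.tgt k - ((((a.src k).val * F.L ^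 (j + 1) : ℕ)) : ZMod ((F.P K).sitesPerDir 0)) + ((8 * F.L ^ (j + 1) : ℕ) : ZMod ((F.P K).sitesPerDir 0))).val < 17 * F.L ^ (j + 1)) then GaugeGroup.dist1 (U b * (U' b)⁻¹) ^ 2 else 0) ≤ (∑ b : PBond (F.P K) 0, if (∀ k, (b.src k - ((((a.src k).val * F.L ^ (j + 1) : ℕ)) : ZMod ((F.P K).sitesPerDir 0)) + ((8 * F.L ^ (j + 1) : ℕ) : ZMod ((F.P K).sitesPerDir 0))).val < 17 * F.L ^ (j + 1)) ∧ (∀ k, (b.tgt k - ((((a.src k).val * F.L ^ (j + 1) : ℕ)) : ZMod ((F.P K).sitesPerDir 0)) + ((8 * F.L ^ (j + 1) : ℕ) : ZMod ((F.P K).sitesPerDir 0))).val < 17 * F.L ^ (j + 1)) then GaugeGroup.dist1 (U b * (GaugeField.gaugeAct k U' b)⁻¹) ^ 2 else 0)) → (∑ b : PBond (F.P K) 0, if (∀ k, (b.src k - ((((a.src k).val * F.L ^ (j + 1) : ℕ)) : ZMod ((F.P K).sitesPerDir 0)) + ((8 * F.L ^ (j + 1) : ℕ) : ZMod ((F.P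 K).sitesPerDir 0))).val < 17 * F.L ^ (j + 1)) ∧ (∀ k, (b.tgt k - ((((a.src k).val * F.L ^ (j + 1) : ℕ)) : ZMod ((F.P K).sitesPerDir 0)) + ((8 * F.L ^ (j + 1) : ℕ) : ZMod ((F.P K).sitesPerDir 0))).val < 17 * F.L ^ (j + 1)) then GaugeGroup.dist1 (U b * (U' b)⁻¹) ^ 2 else 0) ≤ 4 * (F.L : ℝ) ^ (j + 1) / CS ^ 2 → ∃ h : GaugeTransf (F.P K) j (Matrix.specialUnitaryGroup (Fin 2) ℂ), ∀ c : PBond (F.P K) (j + 1), (c = ⟨a.src, a.μ⟩ ∨ c = ⟨a.src.shift a.μ, a.ν⟩ ∨ c = ⟨a.src.shift a.ν, a.μ⟩ ∨ c = ⟨a.src, a.ν⟩) → ∀ b : PBond (F.P K) j, (blockOf b.src = c.src ∨ blockOf b.src = c.tgt) → (blockOf b.tgt = c.src ∨ blockOf b.tgt = c.tgt) → GaugeGroup.dist1 (Averaging.iter (fun i' => BlockAveraging.blockAvg (P := F.P K) (j := i') T3UnitLawDensityEML.ℰp) j U b * (GaugeField.gaugeAct h (Averaging.iter (fun i' => BlockAveraging.blockAvg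 (P := F.P K) (j := i') T3UnitLawDensityEML.ℰp) j U') b)⁻¹) ≤ CS / Real.sqrt ((F.L : ℝ) ^ (j + 1)) * Real.sqrt (∑ b : PBond (F.P K) 0, if (∀ k, (b.src k - ((((a.src k).val * F.L ^ (j + 1) : ℕ)) : ZMod ((F.P K).sitesPerDir 0)) + ((8 * F.L ^ (j + 1) : ℕ) : ZMod ((F.P K).sitesPerDir 0))).val < 17 * F.L ^ (j + 1)) ∧ (∀ k, (b.tgt k - ((((a.src k).val * F.L ^ (j + 1) : ℕ)) : ZMod ((F.P K).sitesPerDir 0)) + ((8 * F.L ^ (j + 1) : ℕ) : ZMod ((F.P K).sitesPerDir 0))).val < 17 * F.L ^ (j + 1)) then GaugeGroup.dist1 (U b * (U' b)⁻¹) ^ 2 else 0)) :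
    open Literature.MathematicalPhysics.QuantumFieldTheory.Balaban1983to89 Literature.MathematicalPhysics.QuantumFieldTheory.Balaban1983to89.T3ContinuumYM3Torus in ∀ (L : ℕ), ∃ CL : ℝ, 0 ≤ CL ∧ ∀ (b₀ p₀ : ℝ), 0 < b₀ → 2 < p₀ → ∃ γ₁ : ℝ, 0 < γ₁ ∧ γ₁ ≤ 1 ∧ ∀ (F : T3Family) (γ : ℝ), F.L = L → 0 < γ → γ ≤ γ₁ → ∀ (K j : ℕ), 1 ≤ j → j + 2 ≤ K → 2 ≤ j → ∀ (a : Plaq (F.P K) j) (U U' : GaugeField (F.P K) 0 (Matrix.specialUnitaryGroup (Fin 2) ℂ)), (∀ (i : ℕ) (q : Plaq (F.P K) i), i < j → Site.tdist (fun k => ((((q.src k).val * F.L ^ i : ℕ)) : ZMod ((F.P K).sitesPerDir 0))) (fun k => ((((a.src k).val * F.L ^ j : ℕ)) : ZMod ((F.P K).sitesPerDir 0))) + 64 * F.L ^ i ≤ 64 * F.L ^ j → GaugeGroup.dist1 (GaugeField.plaqHol (Averaging.iter (fun i' => BlockAveraging.blockAvg (P := F.P K) (j := i') T3UnitLawDensityEML.ℰp)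 i U) q) < T3UnitScaleTilt.θBal F.L γ b₀ p₀ (K - i)) → (∀ (i : ℕ) (q : Plaq (F.P K) i), i < j → Site.tdist (fun k => ((((q.src k).val * F.L ^ i : ℕ)) : ZMod ((F.P K).sitesPerDir 0))) (fun k => ((((a.src k).val * F.L ^ j : ℕ)) : ZMod ((F.P K).sitesPerDir 0))) + 64 * F.L ^ i ≤ 64 * F.L ^ j → GaugeGroup.dist1 (GaugeField.plaqHol (Averaging.iter (fun i' => BlockAveraging.blockAvg (P := F.P K) (j := i') T3UnitLawDensityEML.ℰp) i U') q) < T3UnitScaleTilt.θBal F.L γ b₀ p₀ (K - i)) → |GaugeGroup.dist1 (GaugeField.plaqHol (Averaging.iter (fun i' => BlockAveraging.blockAvg (P := F.P K) (j := i') T3UnitLawDensityEML.ℰp) j U) a) - GaugeGroup.dist1 (GaugeField.plaqHol (Averaging.iter (fun i' => BlockAveraging.blockAvg (P := F.P K) (j := i') T3UnitLawDensityEML.ℰp) j U') a)| ≤ CL / Real.sqrt ((F.L : ℝ) ^ j) * Real.sqrt (∑ b : PBond (F.P K) 0, if (∀ k, (b.src k - ((((a.src k).val * F.L ^ j : ℕ))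 : ZMod ((F.P K).sitesPerDir 0)) + ((8 * F.L ^ j : ℕ) : ZMod ((F.P K).sitesPerDir 0))).val < 17 * F.L ^ j) ∧ (∀ k, (b.tgt k - ((((a.src k).val * F.L ^ j : ℕ)) : ZMod ((F.P K).sitesPerDir 0)) + ((8 * F.L ^ j : ℕ) : ZMod ((F.P K).sitesPerDir 0))).val < 17 * F.L ^ j) then GaugeGroup.dist1 (U b * (U' b)⁻¹) ^ 2 else 0) :=
  stub_iteratedLipschitz_of_avgStabilityModGauge (avgStabilityModGauge_of_orbitMinimising_of_small hSmall)

end Stub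

end Summit.QuantumFields.YangMills.Theorems.PoincareLipschitzAvgStabilityNontrivial
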